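import Summits.MatrixMultiplication.MatrixMultiplication.Theorems.FarEdgeDescentMMCheap
import Summits.MatrixMultiplication.MatrixMultiplication.Theorems.FarEdgeDescentLittleCwTransfer
import Summits.MatrixMultiplication.MatrixMultiplication.Theorems.FarEdgeDescentChord

/-!
# FarEdgeDescent — the CONDITIONAL ω-free recut behind census ask K-cw8 (lens 2, gen 9)

Route `route-MatrixMultiplication-FarEdgeDescent` (rev 7).  The cut of record is
`S ⟺ FiniteSaturation ∧ AnchoredLogConvexity` (`Theorems.FarEdgeDescentChord.node_iff`); the aside
`LittleCwFlat` (stmt-MatrixMultiplication-30671) is an ω-free SUFFICIENT replacement of the special leaf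
(`Theorems.FarEdgeDescentLittleCwTransfer.finiteSaturation_of_littleCwFlat`), and
`Theorems.FarEdgeDescentMMCheap` shows that an MM-cost certificate makes it NECESSARY.  This module
assembles the two into the statement the census ask K-cw8 (NODE-v9 §3.5) would activate:

* `mm_of_littleCwMinimal_and_alc` — unconditional sufficiency of the ω-free node for every `k ≥ 2`:
  `R̃(cw_{k+1}) ≤ k + 2 ∧ AnchoredLogConvexity ⟹ ω = 2`;
* `recut_iff_of_cwCertificate` — given an MM-cost certificate for `cw_{k+1}` at level `k + 2`, the node
  `S ⟺ (R̃(cw_{k+1}) ≤ k + 2) ∧ AnchoredLogConvexity` is EXACT;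
* `recut_iff_of_cw8_degeneration` — the single-step instance: if the little Coppersmith–Winograd tensor
  `cw₈` (format `9 = 3²`) is a degeneration of `⟨3,3,3⟩` (`AlgDegeneratesTo (matMulTensor ℂ 3 3 3)
  (cwTensor ℂ 8)`, a kernel-checkable polynomial-matrix identity, BCS (15.19)), then
  `ω = 2 ⟺ R̃(cw₈) ≤ 9 ∧ AnchoredLogConvexity` — an ω-free special leaf (one asymptotic-rank identity for
  one explicit tensor, whose border rank is `10`, CGLV 2022 §1.2) next to the pencil law.

Whether `⟨3,3,3⟩ ⊵ cw₈` holds is OPEN (orbit dimensions 217 ≥ 212 do not obstruct; the analogous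
`⟨2,2,2⟩ ⊵ cw₃` is impossible, orbit dimensions 37 < 42 — NODE-v9 §3.3).  Support module
(`--supports stmt-MatrixMultiplication-30671`); it closes no item.
-/

noncomputable section

namespace Summit.MatrixMultiplication.MatrixMultiplication.Theorems.FarEdgeDescentCwRecut

set_option linter.dupNamespace false

open Literature.Computability.AlgebraicComplexity
open Summit.MatrixMultiplication.MatrixMultiplication.Theses.FarEdgeDescent
  (FiniteSaturation AnchoredLogConvexity LittleCwFlat closes)
open Summit.MatrixMultiplication.MatrixMultiplication.Theorems.FarEdgeDescentMMCheap
  (asymptoticRank_le_of_mmCheapAt tensorRestrictsTo_self_kroneckerPow_one)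
open Summit.MatrixMultiplication.MatrixMultiplication.Theorems.LittleCwFarEdgeBound
  (finiteSaturation_of_littleCwMinimal)
open Summit.MatrixMultiplication.MatrixMultiplication.Theorems.FarEdgeDescentChord
  (anchoredLogConvexity_of_mm)

/-- **Sufficiency of the ω-free node (unconditional):** `R̃(cw_{k+1}) ≤ k+2` (`k ≥ 2`) and
`AnchoredLogConvexity` give `ω = 2` (transfer to `FiniteSaturation`, then the route's `closes`).
[this route] -/
theorem mm_of_littleCwMinimal_and_alc {k : ℕ} (hk : 2 ≤ k)
    (hr : asymptoticRank (cwTensor ℂ (k + 1)) ≤ (k : ℝ) + 2) (halc : AnchoredLogConvexity) :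
    _root_.MatrixMultiplication :=
  closes (finiteSaturation_of_littleCwMinimal ⟨k, hk, hr⟩) halc

/-- **Exact recut under an MM-cost certificate.**  If `cw_{k+1}` (`k ≥ 2`) carries an MM-cost
certificate at its flattening value `k + 2`, then
`ω = 2 ⟺ R̃(cw_{k+1}) ≤ k + 2 ∧ AnchoredLogConvexity`. [this route] -/
theorem recut_iff_of_cwCertificate {k : ℕ} (hk : 2 ≤ k)
    (h : (∀ ε : ℝ, 0 < ε → ∃ N q a b c : ℕ, 2 ≤ q ∧
      AlgDegeneratesTo (matMulTensor ℂ (q ^ a) (q ^ b) (q ^ c))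
        (kroneckerPow (cwTensor ℂ (k + 1)) (N + 1)) ∧
      (q : ℝ) ^ ((a : ℝ) + b + c - min (a : ℝ) (min (b : ℝ) (c : ℝ))) ≤ (((k : ℝ) + 2) + ε) ^ (N + 1))) :
    _root_.MatrixMultiplication ↔
      (asymptoticRank (cwTensor ℂ (k + 1)) ≤ (k : ℝ) + 2 ∧ AnchoredLogConvexity) :=
  ⟨fun hS => ⟨asymptoticRank_le_of_mmCheapAt hS (by positivity) h, anchoredLogConvexity_of_mm hS⟩,
    fun hx => mm_of_littleCwMinimal_and_alc hk hx.1 hx.2⟩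

/-- A single-step degeneration `⟨3,3,3⟩ ⊵ cw₈` is an MM-cost certificate for `cw₈ = cw_{7+1}` at level
`9 = 7 + 2` (`N = 0`, `q = 3`, `a = b = c = 1`, cost `3^{3-1} = 9`). [this route] -/
theorem cwCertificate_of_cw8_degeneration
    (h : AlgDegeneratesTo (matMulTensor ℂ 3 3 3) (cwTensor ℂ 8)) :
    ∀ ε : ℝ, 0 < ε → ∃ N q a b c : ℕ, 2 ≤ q ∧
      AlgDegeneratesTo (matMulTensor ℂ (q ^ a) (q ^ b) (q ^ c))
        (kroneckerPow (cwTensor ℂ (7 + 1)) (N + 1)) ∧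
      (q : ℝ) ^ ((a : ℝ) + b + c - min (a : ℝ) (min (b : ℝ) (c : ℝ))) ≤ ((((7 : ℕ) : ℝ) + 2) + ε) ^ (N + 1) := by
  intro ε hε
  refine ⟨0, 3, 1, 1, 1, by norm_num, ?_, ?_⟩
  · have h1 : AlgDegeneratesTo (matMulTensor ℂ 3 3 3) (kroneckerPow (cwTensor ℂ 8) 1) :=
      h.trans_restrictsTo (tensorRestrictsTo_self_kroneckerPow_one (cwTensor ℂ 8))
    simpa using h1
  · have hexp : ((1 : ℕ) : ℝ) + (1 : ℕ) + (1 : ℕ) - min ((1 : ℕ) : ℝ) (min ((1 : ℕ) : ℝ) ((1 : ℕ) : ℝ))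
        = (2 : ℕ) := by norm_num
    rw [hexp, Real.rpow_natCast]
    norm_num
    linarith

/-- **K-cw8 payoff (NODE-v9 §3.5).**  If `cw₈` is a degeneration of `⟨3,3,3⟩`, then
`ω = 2 ⟺ R̃(cw₈) ≤ 9 ∧ AnchoredLogConvexity`: the special leaf of the node becomes ONE ω-free
asymptotic-rank identity for one explicit tensor. [this route] -/
theorem recut_iff_of_cw8_degeneration
    (h : AlgDegeneratesTo (matMulTensor ℂ 3 3 3) (cwTensor ℂ 8)) :
    _root_.MatrixMultiplication ↔
      (asymptoticRank (cwTensor ℂ 8) ≤ 9 ∧ AnchoredLogConvexity) := by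
  have h7 := recut_iff_of_cwCertificate (k := 7) (by norm_num) (cwCertificate_of_cw8_degeneration h)
  have e : (7 : ℝ) + 2 = 9 := by norm_num
  simpa [e] using h7

end Summit.MatrixMultiplication.MatrixMultiplication.Theorems.FarEdgeDescentCwRecut

end
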